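import Summits.ValiantsHypothesis.ValiantsHypothesis.Theorems.MonotoneRestorationOrbitRestorationQPSupportBlocks
import HarnessLib

/-!
# Sign-free symmetric affine products are orbit-restorable; the canonical support (ORBIT currency, XVIII)

Route MonotoneRestoration, crux `OrbitRestorationQP` (stmt-ValiantsHypothesis-18293), namespace
`Summit.ValiantsHypothesis.ValiantsHypothesis.Theorems.SignFree`.

An UNCONDITIONAL piece of the `k = 1` sub-rung (ΠΣ) of the first rung of line `depth-three-rung`, with a
hypothesis checkable on the factor list alone:

* `exists_supportAssignment` — **THE CANONICAL SUPPORT.**  There is an assignment `supp : ℂ[x] → Finset (Fin n)`,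
  invariant under nonzero scalars and equivariant under the diagonal action, such that every polynomial admitting
  SOME support `X` with `2|X| + 5 ≤ n` (pointwise stabiliser of `X` fixes it) satisfies `|supp q| ≤ |X|` and is
  fixed by the pointwise stabiliser of `supp q`.  (Construction: `i ∈ supp q` iff fewer than about `n/2`
  transpositions `(i j)` fix `q`; two indices outside `supp q` are exchanged by conjugating with a common partner.)
* `prod_map_ren_eq_of_signFree` — an involution that permutes a multiset of polynomials up to units and rescales
  no member nontrivially preserves the product (pairs of exchanged lines carry inverse units).
* `qpOrbitRestorable_of_signFree` — **SIGN-FREE ΠΣ FAMILIES ARE ORBIT-RESTORABLE**: a nonzero, diagonally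
  `Sym(Fin n)`-invariant product `a · Π L` of fewer than `C(n,k)` degree-one forms (`n > 8`, `4k ≤ n`) in which
  NO TRANSPOSITION RESCALES ANY FACTOR NONTRIVIALLY (`(i j) · ℓ = u ℓ ⇒ u = 1`) is `QPOrbitRestorable (k + 5)`:
  supports from `AffineFactors.exists_support_of_mem_factors` (Dixon–Mortimer), made canonical here, blocks
  untwisted by `prod_map_ren_eq_of_signFree`, then `SupportBlocks.qpOrbitRestorable_of_untwisted_supportBlocks`.

The sign-twisted case (factors negated by transpositions, e.g. `x_ik − x_jk`) is where the blocks must be keyed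
differently (`…NonAttacking.lean` and the census of the seat); everything here is proved. [folklore]

## References
* A. Dawar, G. Wilsenach, *Symmetric arithmetic circuits*, ToC 21 (2025), §3.3, Def. 6.1, §6. [DawarWilsenach2025]
* J. D. Dixon, B. Mortimer, *Permutation Groups*, GTM 163 (1996), Thm 5.2B. [DixonMortimer1996]
-/

noncomputable section

open scoped Classical Pointwise

-- `Summit.ValiantsHypothesis.ValiantsHypothesis.…` is the tree's single-conjunct layout (Sub = Summit).
set_option linter.dupNamespace false

namespace Summit.ValiantsHypothesis.ValiantsHypothesis.Theorems

namespace SignFree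

open Equiv Finset Literature.Computability.AlgebraicComplexity OrbitRestorationQPDepthThreeRung

variable {n : ℕ}

/-! ### Transpositions -/

/-- A transposition of two elements of `T` maps `T` to itself. [folklore] -/
theorem swap_smul_finset_eq {T : Finset (Fin n)} {x y : Fin n} (hx : x ∈ T) (hy : y ∈ T) : swap x y • T = T := by
  apply Finset.eq_of_subset_of_card_le
  · intro z hz
    obtain ⟨w, hw, rfl⟩ := Finset.mem_smul_finset.1 hz
    rw [Perm.smul_def, swap_apply_def]
    split_ifs <;> assumption
  · rw [Finset.card_smul_finset]

/-- Exchanging two indices through a common partner: `(a b) = (a m)(b m)(a m)`. [folklore] -/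
theorem ren_swap_eq_of_partner {q : MvPolynomial (Fin n × Fin n) ℂ} {a b m : Fin n} (hab : a ≠ b)
    (hbm : b ≠ m) (ha : ren (swap a m) q = q) (hb : ren (swap b m) q = q) : ren (swap a b) q = q := by
  have h : swap a b = swap a m * swap b m * swap a m := by
    have := Equiv.swap_mul_swap_mul_swap (x := b) (y := a) (z := m) hab.symm hbm
    -- `swap a m * swap b a * swap a m = swap m b`
    rw [swap_comm b a] at this
    calc swap a b = swap a m * (swap a m * swap a b * swap a m) * swap a m := by
          rw [← mul_assoc, ← mul_assoc, swap_mul_self, one_mul, mul_assoc, swap_mul_self, mul_one]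
      _ = swap a m * swap m b * swap a m := by rw [this]
      _ = swap a m * swap b m * swap a m := by rw [swap_comm m b]
  rw [h, ren_mul, ren_mul, ha, hb, ha]

/-! ### The canonical support -/

/-- **The canonical support assignment.**  There is `supp : ℂ[x_ij] → Finset (Fin n)` with:
(S1) `supp (u · q) = supp q` for `u ≠ 0`; (S2) `supp (σ · q) = σ • supp q`; (S3) whenever the pointwise
stabiliser of some `X` with `2|X| + 5 ≤ n` fixes `q`, then `|supp q| ≤ |X|` and the pointwise stabiliser of
`supp q` fixes `q`. [folklore; cite: DawarWilsenach2025, Def. 6.1] -/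
theorem exists_supportAssignment (n : ℕ) :
    ∃ supp : MvPolynomial (Fin n × Fin n) ℂ → Finset (Fin n),
      (∀ (q : MvPolynomial (Fin n × Fin n) ℂ) (u : ℂ), u ≠ 0 → supp (MvPolynomial.C u * q) = supp q) ∧
      (∀ (q : MvPolynomial (Fin n × Fin n) ℂ) (σ : Perm (Fin n)), supp (ren σ q) = σ • supp q) ∧
      (∀ (q : MvPolynomial (Fin n × Fin n) ℂ) (X : Finset (Fin n)), 2 * X.card + 5 ≤ n →
        (∀ τ : Perm (Fin n), (∀ x ∈ X, τ x = x) → ren τ q = q) →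
        (supp q).card ≤ X.card ∧ ∀ τ : Perm (Fin n), (∀ x ∈ supp q, τ x = x) → ren τ q = q) := by
  -- partners of `i`: the `j` with `(i j) · q = q`
  let P : MvPolynomial (Fin n × Fin n) ℂ → Fin n → Finset (Fin n) := fun q i =>
    (univ : Finset (Fin n)).filter fun j => ren (swap i j) q = q
  let supp : MvPolynomial (Fin n × Fin n) ℂ → Finset (Fin n) := fun q =>
    (univ : Finset (Fin n)).filter fun i => (P q i).card ≤ n / 2 + 1
  have hP : ∀ q i j, j ∈ P q i ↔ ren (swap i j) q = q := fun q i j => by simp [P]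
  have hsupp : ∀ q i, i ∈ supp q ↔ (P q i).card ≤ n / 2 + 1 := fun q i => by simp [supp]
  refine ⟨supp, fun q u hu => ?_, fun q σ => ?_, fun q X hX hfix => ?_⟩
  · -- (S1)
    have hPq : ∀ i, P (MvPolynomial.C u * q) i = P q i := by
      intro i
      ext j
      rw [hP, hP, map_mul, ren_C]
      constructor
      · intro h
        exact mul_left_cancel₀ (show (MvPolynomial.C u : MvPolynomial (Fin n × Fin n) ℂ) ≠ 0 from by
          rw [Ne, MvPolynomial.C_eq_zero]; exact hu) h
      · intro h; rw [h]
    ext i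
    rw [hsupp, hsupp, hPq]
  · -- (S2)
    -- conjugating a transposition: `(i j) = σ (σ⁻¹ i  σ⁻¹ j) σ⁻¹`
    have hconj : ∀ i j : Fin n, swap i j = σ * swap (σ⁻¹ i) (σ⁻¹ j) * σ⁻¹ := by
      intro i j
      have := Equiv.swap_apply_apply σ (σ⁻¹ i) (σ⁻¹ j)
      rwa [show σ (σ⁻¹ i) = i from σ.apply_symm_apply i, show σ (σ⁻¹ j) = j from σ.apply_symm_apply j] at this
    have hiff : ∀ i j : Fin n, ren (swap i j) (ren σ q) = ren σ q ↔ ren (swap (σ⁻¹ i) (σ⁻¹ j)) q = q := by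
      intro i j
      rw [hconj i j, ren_mul, ren_mul, ren_inv_ren]
      exact (ren_injective σ).eq_iff
    have hPσ : ∀ i, P (ren σ q) i = σ • P q (σ⁻¹ i) := by
      intro i
      ext j
      rw [hP, hiff, Finset.mem_smul_finset]
      constructor
      · intro h
        exact ⟨σ⁻¹ j, (hP _ _ _).2 h, σ.apply_symm_apply j⟩
      · rintro ⟨j', hj', rfl⟩
        rw [Perm.smul_def, show σ⁻¹ (σ j') = j' from σ.symm_apply_apply j']
        exact (hP _ _ _).1 hj'
    ext i
    rw [hsupp, hPσ, Finset.card_smul_finset, Finset.mem_smul_finset]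
    constructor
    · intro h; exact ⟨σ⁻¹ i, (hsupp _ _).2 h, σ.apply_symm_apply i⟩
    · rintro ⟨i', hi', rfl⟩
      rw [Perm.smul_def, show σ⁻¹ (σ i') = i' from σ.symm_apply_apply i']
      exact (hsupp _ _).1 hi'
  · -- (S3)
    -- outside `X` everybody has many partners
    have hbig : ∀ i, i ∉ X → n / 2 + 1 < (P q i).card := by
      intro i hi
      have hsub : Xᶜ ⊆ P q i := by
        intro j hj
        rw [Finset.mem_compl] at hj
        rw [hP]
        by_cases hij : i = j
        · subst hij; rw [swap_self]; exact ren_one q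
        · exact hfix _ fun x hx => swap_apply_of_ne_of_ne (by rintro rfl; exact hi hx) (by rintro rfl; exact hj hx)
      have := Finset.card_le_card hsub
      rw [Finset.card_compl, Fintype.card_fin] at this
      omega
    have hsub : supp q ⊆ X := by
      intro i hi
      by_contra hiX
      have := (hsupp q i).1 hi
      have := hbig i hiX
      omega
    refine ⟨Finset.card_le_card hsub, ?_⟩
    -- two indices outside `supp q` are exchanged through a common partner
    have hswap : ∀ a b, a ∉ supp q → b ∉ supp q → ren (swap a b) q = q := by
      intro a b ha hb
      by_cases hab : a = b
      · subst hab; rw [swap_self]; exact ren_one q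
      rw [hsupp, not_le] at ha hb
      have hcard : 0 < ((P q a ∩ P q b) \ {a, b}).card := by
        have h1 : (P q a ∩ P q b).card + (P q a ∪ P q b).card = (P q a).card + (P q b).card :=
          Finset.card_inter_add_card_union _ _
        have h2 : (P q a ∪ P q b).card ≤ n := by
          have := Finset.card_le_univ (P q a ∪ P q b); rwa [Fintype.card_fin] at this
        have h3 : ((P q a ∩ P q b) \ {a, b}).card + ({a, b} : Finset (Fin n)).card ≥ (P q a ∩ P q b).card := by
          have := Finset.card_le_card_sdiff_add_card (s := P q a ∩ P q b) (t := {a, b})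
          omega
        have h4 : ({a, b} : Finset (Fin n)).card = 2 := Finset.card_pair hab
        omega
      obtain ⟨m, hm⟩ : ((P q a ∩ P q b) \ {a, b}).Nonempty := Finset.card_pos.1 hcard
      simp only [Finset.mem_sdiff, Finset.mem_inter, Finset.mem_insert, Finset.mem_singleton, not_or] at hm
      exact ren_swap_eq_of_partner hab (Ne.symm hm.2.2) ((hP _ _ _).1 hm.1.1) ((hP _ _ _).1 hm.1.2)
    -- permutations fixing `supp q` pointwise are products of such transpositions
    intro τ hτ
    have hτp : ∀ x, τ x ∉ supp q ↔ x ∉ supp q := by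
      intro x
      by_cases hx : x ∈ supp q
      · rw [hτ x hx]
      · refine ⟨fun _ => hx, fun _ hτx => ?_⟩
        have h1 : τ (τ x) = τ x := hτ _ hτx
        exact hx (τ.injective h1 ▸ hτx)
    have h2 : ∀ x, τ x ≠ x → x ∉ supp q := fun x hx hxS => hx (hτ x hxS)
    have key : ∀ π : Perm {x // x ∉ supp q}, ren (Perm.ofSubtype π) q = q := by
      intro π
      induction π using Perm.swap_induction_on with
      | one => rw [map_one, ren_one]
      | swap_mul π x y hxy ih => rw [map_mul, Perm.ofSubtype_swap_eq, ren_mul, ih, hswap _ _ x.2 y.2]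
    have := key (τ.subtypePerm hτp)
    rwa [Perm.ofSubtype_subtypePerm hτp h2] at this

/-! ### Involutions permuting a multiset up to units -/

/-- **A sign-free involution preserves the product.**  Let `τ` be an involution and `A` a multiset of nonzero
polynomials such that `τ · A` and `A` have the same associates, and no member of `A` is rescaled nontrivially by
`τ` (`τ · ℓ = u ℓ ⇒ u = 1`).  Then `Π (τ · A) = Π A`: a member is either fixed, or exchanged with another member
with inverse units. [folklore] -/
theorem prod_map_ren_eq_of_signFree (τ : Perm (Fin n)) (hτ : τ * τ = 1) :
    ∀ (A : Multiset (MvPolynomial (Fin n × Fin n) ℂ)), (∀ ℓ ∈ A, ℓ ≠ 0) →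
      (A.map (ren τ)).map Associates.mk = A.map Associates.mk →
      (∀ ℓ ∈ A, ∀ u : ℂ, ren τ ℓ = MvPolynomial.C u * ℓ → u = 1) → (A.map (ren τ)).prod = A.prod := by
  have hττ : ∀ p : MvPolynomial (Fin n × Fin n) ℂ, ren τ (ren τ p) = p := fun p => by
    rw [← ren_mul, hτ, ren_one]
  intro A
  induction h : Multiset.card A using Nat.strong_induction_on generalizing A with
  | _ N ih =>
    intro hA0 hmk hsf
    rcases Multiset.empty_or_exists_mem A with rfl | ⟨ℓ, hℓ⟩
    · simp
    · -- `τ ℓ` is associated to some member `ℓ'`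
      have hmem : Associates.mk (ren τ ℓ) ∈ A.map Associates.mk := by
        rw [← hmk]; exact Multiset.mem_map.2 ⟨ren τ ℓ, Multiset.mem_map.2 ⟨ℓ, hℓ, rfl⟩, rfl⟩
      obtain ⟨ℓ', hℓ', hℓ'eq⟩ := Multiset.mem_map.1 hmem
      obtain ⟨u, hu0, hu⟩ := SupportBlocks.exists_C_of_associated (Associates.mk_eq_mk_iff_associated.1 hℓ'eq)
      -- `hu : ren τ ℓ = C u * ℓ'`
      obtain ⟨A', rfl⟩ := Multiset.exists_cons_of_mem hℓ
      by_cases hfix : ℓ' = ℓ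
      · -- fixed line: `u = 1`
        rw [hfix] at hu
        have hu1 : u = 1 := hsf ℓ hℓ u hu
        rw [hu1, map_one, one_mul] at hu
        have hmk' : (A'.map (ren τ)).map Associates.mk = A'.map Associates.mk := by
          rw [Multiset.map_cons, Multiset.map_cons, Multiset.map_cons, hu] at hmk
          exact (Multiset.cons_inj_right _).1 hmk
        have hIH := ih (Multiset.card A') (by rw [← h, Multiset.card_cons]; exact Nat.lt_succ_self _) A' rfl
          (fun x hx => hA0 x (Multiset.mem_cons_of_mem hx)) hmk' (fun x hx => hsf x (Multiset.mem_cons_of_mem hx))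
        rw [Multiset.map_cons, Multiset.prod_cons, Multiset.prod_cons, hu, hIH]
      · -- exchanged pair: `τ ℓ = u ℓ'`, `τ ℓ' = u⁻¹ ℓ`
        have hℓ'A' : ℓ' ∈ A' := (Multiset.mem_cons.1 hℓ').resolve_left hfix
        obtain ⟨A'', rfl⟩ := Multiset.exists_cons_of_mem hℓ'A'
        have hu' : ren τ ℓ' = MvPolynomial.C u⁻¹ * ℓ := by
          have h1 := congrArg (ren τ) hu
          rw [hττ, map_mul, ren_C] at h1
          rw [h1, ← mul_assoc, ← map_mul, inv_mul_cancel₀ hu0, map_one, one_mul]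
        have e1 : Associates.mk (MvPolynomial.C u * ℓ') = Associates.mk ℓ' :=
          Associates.mk_eq_mk_iff_associated.2
            (associated_unit_mul_left _ _ ((isUnit_iff_ne_zero.2 hu0).map MvPolynomial.C))
        have e2 : Associates.mk (MvPolynomial.C u⁻¹ * ℓ) = Associates.mk ℓ :=
          Associates.mk_eq_mk_iff_associated.2
            (associated_unit_mul_left _ _ ((isUnit_iff_ne_zero.2 (inv_ne_zero hu0)).map MvPolynomial.C))
        have hmk'' : (A''.map (ren τ)).map Associates.mk = A''.map Associates.mk := by
          have h3 : Associates.mk ℓ' ::ₘ Associates.mk ℓ ::ₘ (A''.map (ren τ)).map Associates.mk =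
              Associates.mk ℓ ::ₘ Associates.mk ℓ' ::ₘ A''.map Associates.mk := by
            have h4 := hmk
            rw [Multiset.map_cons, Multiset.map_cons, Multiset.map_cons, Multiset.map_cons, Multiset.map_cons,
              Multiset.map_cons, hu, hu', e1, e2] at h4
            exact h4
          rw [Multiset.cons_swap] at h3
          exact (Multiset.cons_inj_right _).1 ((Multiset.cons_inj_right _).1 h3)
        have hcard : Multiset.card A'' < N := by
          rw [← h, Multiset.card_cons, Multiset.card_cons]; omega
        have hIH := ih _ hcard A'' rfl (fun x hx => hA0 x (Multiset.mem_cons_of_mem (Multiset.mem_cons_of_mem hx)))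
          hmk'' (fun x hx => hsf x (Multiset.mem_cons_of_mem (Multiset.mem_cons_of_mem hx)))
        have hscal : MvPolynomial.C u * ℓ' * (MvPolynomial.C u⁻¹ * ℓ) = ℓ * ℓ' := by
          calc MvPolynomial.C u * ℓ' * (MvPolynomial.C u⁻¹ * ℓ)
              = MvPolynomial.C (u * u⁻¹) * (ℓ * ℓ') := by rw [map_mul]; ring
            _ = ℓ * ℓ' := by rw [mul_inv_cancel₀ hu0, map_one, one_mul]
        rw [Multiset.map_cons, Multiset.map_cons, Multiset.prod_cons, Multiset.prod_cons, Multiset.prod_cons,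
          Multiset.prod_cons, hu, hu', hIH, ← mul_assoc, hscal, mul_assoc]

/-! ### Sign-free symmetric affine products -/

/-- **SIGN-FREE SYMMETRIC ΠΣ FAMILIES ARE ORBIT-RESTORABLE.**  Let `n > 8`, `1 ≤ k`, `4k ≤ n`, and let
`f = a · Π L ≠ 0` be a product of fewer than `C(n,k)` forms of total degree `1` on the `n × n` matrix,
invariant under the diagonal action of `Sym(Fin n)`, such that no transposition rescales any factor
nontrivially: `(i j) · ℓ = u · ℓ ⇒ u = 1`.  Then `f` is `QPOrbitRestorable (k + 5)` at level `n`.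
[folklore; cite: DawarWilsenach2025, §3.3 and §6; DixonMortimer1996, Thm 5.2B] -/
theorem qpOrbitRestorable_of_signFree {k : ℕ} (hn : 8 < n) (hk : 1 ≤ k) (h4k : 4 * k ≤ n)
    (L : Multiset (MvPolynomial (Fin n × Fin n) ℂ)) (a : ℂ)
    (hL1 : ∀ ℓ ∈ L, ℓ.totalDegree = 1) (hcard : Multiset.card L < n.choose k)
    (hf0 : MvPolynomial.C a * L.prod ≠ 0)
    (hfix : ∀ σ : Perm (Fin n), ren σ (MvPolynomial.C a * L.prod) = MvPolynomial.C a * L.prod)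
    (hsf : ∀ ℓ ∈ L, ∀ (i j : Fin n) (u : ℂ), ren (swap i j) ℓ = MvPolynomial.C u * ℓ → u = 1) :
    QPOrbitRestorable (k + 5) n (MvPolynomial.C a * L.prod) := by
  obtain ⟨supp, S1, S2, S3⟩ := exists_supportAssignment n
  -- supports of the factors (Dixon–Mortimer), made canonical
  have hfac : ∀ ℓ ∈ L, (supp ℓ).card ≤ k ∧ ∀ τ : Perm (Fin n), (∀ x ∈ supp ℓ, τ x = x) → ren τ ℓ = ℓ := by
    intro ℓ hℓ
    obtain ⟨X, hXk, hX⟩ := AffineFactors.exists_support_of_mem_factors hn hk h4k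
      (fun ℓ hℓ => (hL1 ℓ hℓ).le) hcard hf0 hfix hℓ
    obtain ⟨h1, h2⟩ := S3 ℓ X (by omega) hX
    exact ⟨h1.trans (by omega), h2⟩
  refine SupportBlocks.qpOrbitRestorable_of_untwisted_supportBlocks L a supp S1 S2 (fun ℓ hℓ => (hfac ℓ hℓ).2)
    (fun ℓ hℓ => (hfac ℓ hℓ).1) hL1 hf0 hfix fun T x hx y hy => ?_
  -- the block at `T` is untwisted: `(x y)` permutes it up to units, sign-freely
  set A := L.filter fun ℓ => supp ℓ = T with hA
  have hmk : (A.map (ren (swap x y))).map Associates.mk = A.map Associates.mk := by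
    have hP : ∀ p q : MvPolynomial (Fin n × Fin n) ℂ, Associated p q → (supp p = T ↔ supp q = T) := by
      intro p q hpq
      obtain ⟨c, hc0, rfl⟩ := SupportBlocks.exists_C_of_associated hpq
      rw [S1 p c hc0]
    have h1 := SupportBlocks.map_mk_filter_eq hP (SupportBlocks.map_mk_map_ren_eq hL1 hf0 hfix (swap x y))
    have h2 : (L.map (ren (swap x y))).filter (fun ℓ => supp ℓ = T) = A.map (ren (swap x y)) := by
      rw [hA, Multiset.filter_map]
      congr 1
      refine Multiset.filter_congr fun ℓ _ => ?_
      simp only [Function.comp_apply, S2]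
      constructor
      · intro h
        have := congrArg (fun S => (swap x y)⁻¹ • S) h
        simp only [inv_smul_smul] at this
        rw [this, swap_inv, swap_smul_finset_eq hx hy]
      · intro h; rw [h, swap_smul_finset_eq hx hy]
    rw [h2] at h1
    exact h1
  have hA0 : ∀ ℓ ∈ A, ℓ ≠ 0 := fun ℓ hℓ => AffineFactors.ne_zero_of_mem hf0 (Multiset.mem_filter.1 hℓ).1
  have := prod_map_ren_eq_of_signFree (swap x y) (swap_mul_self x y) A hA0 hmk
    fun ℓ hℓ u hu => hsf ℓ (Multiset.mem_filter.1 hℓ).1 x y u hu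
  rw [map_multiset_prod, this]

end SignFree

end Summit.ValiantsHypothesis.ValiantsHypothesis.Theorems

end
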